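import Summits.CriticalPhenomena.PercolationContinuityZ3.Theorems.PercNearOneGluingNoHeavyLowerTailQuantitativeHarrisExplicitStrictness
import Summits.CriticalPhenomena.PercolationContinuityZ3.Theorems.PercNearOneGluingNoHeavyLowerTailQuantitativeHarrisSharpStrictness
import Summits.CriticalPhenomena.PercolationContinuityZ3.Theorems.PercNearOneGluingNoHeavyLowerTailQuantitativeS5FloorCompleteFar
import Summits.CriticalPhenomena.PercolationContinuityZ3.Theorems.PercNearOneGluingNoHeavyLowerTailQuantitativeGenZeroSet
import HarnessLib

/-!
# The explicit (S5)-margin floor from ONE isolated witness, with the SHARP Harris exponent: `margin ≥ p₀^{|E|}·(p₀(1−p₀))^{|E|}·J`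

Support file (`--supports stmt-CriticalPhenomena-4575`), prover seat `prim-rate-mine-2` (lane prim-rate, constants-miner (c), BENCH row
M2-R48; `run/shared/lean/prim/prim-rate/prim-rate-mine-2/PROOFS.md` §P48).  No definitions, no named facts, no sorries; standard axioms.

Row M2-R47's file `…QuantitativeS5FloorExplicit.lean` proved `p₀^{3|E|+2}·J ≤ s5dMargin w T r [] o v F` from one isolated witness, using
`QuantHarris.cov_ge_pow_mul_jumps` (`p₀^{2|E|+2}·J₁J₂ ≤ Cov`).  Row M2-R48 replaced that Harris floor by the SHARP one,
`QuantHarris.cov_ge_prodPow_mul_jumps` (`(p₀(1−p₀))^{|E|}·J₁J₂ ≤ Cov`, equality for AND/OR).  THIS FILE re-runs the two statements with it: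

* `CSH.floor_iso_ge_explicit_sharp` — the `a`-term `∏(1 − w)·Cov` of the explicit floor is **`≥ p₀^{|E|}·(p₀(1−p₀))^{|E|}·J`** given a pair
  `e ∈ E` missing `T_{<a}` with an `F(V 𝒞_a)`-witness `η₁` (jump `J`) and an event witness `η₂` inside the pairs of `E` missing `T_{<a}`
  (`∏(1 − w) ≥ p₀^{|E|}` unchanged; the Harris factor improves from `p₀^{2|E|+2}` to `(p₀(1−p₀))^{|E|}`);
* `CSH.s5dMargin_nil_ge_explicit_sharp` — hence **`p₀^{|E|}·(p₀(1−p₀))^{|E|}·J ≤ s5dMargin w T r [] o v F`** at a compatible injective rank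
  (other summands `≥ 0`, floor `≤` margin).
* `CSH.surplus_ge_explicit_sharp` — the MASTER FORM (GEN): `A` relays with top relay `k` (rank-maximal), `o ∉ A`, the same isolated witness at
  a relay `a ∈ A ∖ k` with second observer `k`: **`p₀^{|E|}·(p₀(1−p₀))^{|E|}·J ≤ surplus w A r F o`** (the GEN peeling identity
  `CSH.surplus_peel_top`: `μ(D_k)·Sur_o(A) = μ(D_k)·s5dMargin(A∖k; o, k) + covD + γ_k·μ(D_k ∩ {o↔k})` with the last two pieces `≥ 0`,
  `CSH.surplus_pieces_nonneg`, and `μ(D_k) > 0`) — the first explicit constant for the master inequality (GEN) itself.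
Same hypotheses, binders and argument order as the M2-R47 versions (drop-in).  For `p₀ ≤ ½` the new constant dominates the old one by the
factor `(1−p₀)^{|E|}·p₀^{−|E|−2} ≥ 4`.
[cite: Harris1960, Lemma 4.1 (p. 16)] [cite: KozmaNitzan2024, Conj. 4 (p. 32)] [cite: Talagrand1996, Thm. 1.1 (p. 244)]
-/

noncomputable section

namespace Summit.CriticalPhenomena.PercolationContinuityZ3.Theorems

open MeasureTheory Set Literature.Probability.LatticeModels Literature.Probability.Percolation
open scoped Classical
open KNPreFKG

namespace CSH

variable {n : ℕ}

/-- **Explicit isolated Harris term.**  Weights `w = 0` off the finite support `E`, `p₀ ≤ w ≤ 1 − p₀` on `E` (`0 < p₀`); `F` monotone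
nonnegative; a pair `e ∈ E` missing `T_{<a}`, an `F(V 𝒞_a)`-witness `η₁` (jump `J`) and a witness `η₂` for the floor's event, both inside the
pairs of `E` missing `T_{<a}`.  Then the `a`-term `∏(1 − w)·Cov` of the floor (general decoy list) is at least `p₀^{|E|}·(p₀(1−p₀))^{|E|}·J`
(sharp Harris exponent, row M2-R48). [cite: Harris1960, Lemma 4.1 (p. 16)] [cite: Talagrand1996, Thm. 1.1 (p. 244)] -/
theorem floor_iso_ge_explicit_sharp (w : Sym2 (Fin n) → unitInterval) (E : Finset (Sym2 (Fin n))) (p₀ : ℝ) (hp0 : 0 < p₀)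
    (hE0 : ∀ f, f ∉ E → (w f : ℝ) = 0) (hE1 : ∀ f ∈ E, p₀ ≤ (w f : ℝ) ∧ (w f : ℝ) ≤ 1 - p₀) (o v : Fin n)
    (T : Finset (Fin n)) (r : Fin n → ℕ) (D : List (Fin n)) (a : Fin n)
    (F : Set (Fin n) → ℝ) (hF : ∀ S S' : Set (Fin n), S ⊆ S' → F S ≤ F S') (hF0 : ∀ S : Set (Fin n), 0 ≤ F S)
    (e : Sym2 (Fin n)) (heE : e ∈ E) (heY : ∀ y ∈ (↑(T.filter (fun b => r b < r a)) : Set (Fin n)), y ∉ e)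
    (η₁ : Set (Sym2 (Fin n))) (hη₁ : η₁ ⊆ {f | f ∈ (↑E : Set (Sym2 (Fin n))) ∧ ∀ y ∈ (↑(T.filter (fun b => r b < r a)) : Set (Fin n)), y ∉ f})
    (η₂ : Set (Sym2 (Fin n))) (hη₂ : η₂ ⊆ {f | f ∈ (↑E : Set (Sym2 (Fin n))) ∧ ∀ y ∈ (↑(T.filter (fun b => r b < r a)) : Set (Fin n)), y ∉ f})
    (hU1 : insert e η₂ ∈ ((⋃ t ∈ (insert a (T.filter (fun b => r a < r b) ∪ D.toFinset)), openConn o t) ∪ openConn o v :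
        Set (BondConfig (Fin n))))
    (hU0 : η₂ \ {e} ∉ ((⋃ t ∈ (insert a (T.filter (fun b => r a < r b) ∪ D.toFinset)), openConn o t) ∪ openConn o v :
        Set (BondConfig (Fin n)))) :
    p₀ ^ E.card * (p₀ * (1 - p₀)) ^ E.card *
        (F {c | c = a ∨ ∃ e' ∈ openEdgeCluster (insert e η₁) a, c ∈ e'} - F {c | c = a ∨ ∃ e' ∈ openEdgeCluster (η₁ \ {e}) a, c ∈ e'}) ≤
      (∏ e ∈ Finset.univ.filter (fun e : Sym2 (Fin n) => ∃ y ∈ (↑(T.filter (fun b => r b < r a)) : Set (Fin n)), y ∈ e), (1 - (w e : ℝ))) *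
          ((∫ η in ((⋃ t ∈ (insert a (T.filter (fun b => r a < r b) ∪ (D).toFinset)), openConn o t) ∪ openConn o v),
              F {c | c = a ∨ ∃ e ∈ openEdgeCluster η a, c ∈ e}
              ∂(prodBernoulli fun e => if (∃ y ∈ (↑(T.filter (fun b => r b < r a)) : Set (Fin n)), y ∈ e) then (0 : unitInterval) else w e)) -
            (prodBernoulli fun e => if (∃ y ∈ (↑(T.filter (fun b => r b < r a)) : Set (Fin n)), y ∈ e) then (0 : unitInterval) else w e).real
                ((⋃ t ∈ (insert a (T.filter (fun b => r a < r b) ∪ (D).toFinset)), openConn o t) ∪ openConn o v) *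
              (∫ η, F {c | c = a ∨ ∃ e ∈ openEdgeCluster η a, c ∈ e}
                ∂(prodBernoulli fun e => if (∃ y ∈ (↑(T.filter (fun b => r b < r a)) : Set (Fin n)), y ∈ e) then (0 : unitInterval) else w e))) := by
  have hmeas : ∀ S : Set (BondConfig (Fin n)), MeasurableSet S := fun _ => MeasurableSet.of_discrete
  have hp01 : p₀ ≤ 1 := by linarith [(hE1 e heE).1, (hE1 e heE).2]
  set Y : Set (Fin n) := (↑(T.filter (fun b => r b < r a)) : Set (Fin n)) with hY
  set U : Set (BondConfig (Fin n)) :=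
    (⋃ t ∈ (insert a (T.filter (fun b => r a < r b) ∪ D.toFinset)), openConn o t) ∪ openConn o v with hU
  set qY : Sym2 (Fin n) → unitInterval := fun e => if (∃ y ∈ Y, y ∈ e) then (0 : unitInterval) else w e with hqY
  set EY : Finset (Sym2 (Fin n)) := E.filter (fun f => ∀ y ∈ Y, y ∉ f) with hEY
  set f : BondConfig (Fin n) → ℝ := fun ζ => F {c | c = a ∨ ∃ e ∈ openEdgeCluster ζ a, c ∈ e} with hfdef
  have hUup : ∀ ω ω' : BondConfig (Fin n), ω ⊆ ω' → ω ∈ U → ω' ∈ U := by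
    rintro ω ω' hle (h | h)
    · obtain ⟨t, ht, h⟩ := Set.mem_iUnion₂.1 h
      exact Or.inl (Set.mem_iUnion₂.2 ⟨t, ht, SimpleGraph.Reachable.mono (BHK2006.openGraph_le hle) h⟩)
    · exact Or.inr (SimpleGraph.Reachable.mono (BHK2006.openGraph_le hle) h)
  have hfmono : Monotone f := fun _ _ h => (monotone_clusterFun a F hF) (BHK2006.openEdgeCluster_mono h a)
  have hf0 : ∀ ζ, 0 ≤ f ζ := fun _ => hF0 _
  -- the zeroed weights: support `EY ⊆ E`, same bounds
  have hq0 : ∀ g, g ∉ EY → ((qY g : unitInterval) : ℝ) = 0 := by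
    intro g hg
    simp only [hqY]
    by_cases hc : ∃ y ∈ Y, y ∈ g
    · rw [if_pos hc]; rfl
    · rw [if_neg hc]
      apply hE0 g
      intro hgE
      exact hg (Finset.mem_filter.2 ⟨hgE, fun y hy hyg => hc ⟨y, hy, hyg⟩⟩)
  have hq1 : ∀ g ∈ EY, p₀ ≤ ((qY g : unitInterval) : ℝ) ∧ ((qY g : unitInterval) : ℝ) ≤ 1 - p₀ := by
    intro g hg
    obtain ⟨hgE, hgY⟩ := Finset.mem_filter.1 hg
    have hc : ¬ ∃ y ∈ Y, y ∈ g := by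
      rintro ⟨y, hy, hyg⟩
      exact hgY y hy hyg
    simp only [hqY]
    rw [if_neg hc]
    exact hE1 g hgE
  have heEY : e ∈ EY := Finset.mem_filter.2 ⟨heE, heY⟩
  have hη₁' : η₁ ⊆ ↑EY := fun g hg => Finset.mem_coe.2 (Finset.mem_filter.2 ⟨Finset.mem_coe.1 (hη₁ hg).1, (hη₁ hg).2⟩)
  have hη₂' : η₂ ⊆ ↑EY := fun g hg => Finset.mem_coe.2 (Finset.mem_filter.2 ⟨Finset.mem_coe.1 (hη₂ hg).1, (hη₂ hg).2⟩)
  -- explicit Harris strictness at the zeroed weights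
  have hcov := QuantHarris.cov_ge_prodPow_mul_jumps qY EY p₀ hp0.le hq0 hq1 f (U.indicator fun _ => (1 : ℝ)) hf0
    (fun ω => Set.indicator_nonneg (fun _ _ => zero_le_one) ω) hfmono (QuantHarris.indicator_upset_monotone hUup)
    e heEY η₁ hη₁' η₂ hη₂'
  rw [Set.indicator_of_mem hU1, Set.indicator_of_notMem hU0, sub_zero, mul_one] at hcov
  have hprod : (fun ζ => f ζ * U.indicator (fun _ => (1 : ℝ)) ζ) = U.indicator f := by
    funext ζ
    by_cases hζ : ζ ∈ U
    · rw [Set.indicator_of_mem hζ, Set.indicator_of_mem hζ, mul_one]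
    · rw [Set.indicator_of_notMem hζ, Set.indicator_of_notMem hζ, mul_zero]
  rw [hprod, integral_indicator (hmeas U), integral_indicator (hmeas U)] at hcov
  simp only [integral_const, smul_eq_mul, mul_one, measureReal_restrict_apply_univ] at hcov
  -- hcov : (p₀(1-p₀)) ^ EY.card * J ≤ ∫_U f − (∫ f) * μ(U)
  have hJ0 : 0 ≤ f (insert e η₁) - f (η₁ \ {e}) := sub_nonneg.2 (hfmono (fun x hx => Set.mem_insert_of_mem e hx.1))
  have hcardEY : EY.card ≤ E.card := Finset.card_filter_le _ _
  -- the prefactor `∏ (1 − w) ≥ p₀ ^ |E|`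
  have hpref : p₀ ^ E.card ≤ ∏ g ∈ Finset.univ.filter (fun g : Sym2 (Fin n) => ∃ y ∈ Y, y ∈ g), (1 - (w g : ℝ)) := by
    have hsplit := Finset.prod_filter_mul_prod_filter_not (Finset.univ.filter (fun g : Sym2 (Fin n) => ∃ y ∈ Y, y ∈ g))
      (fun g => g ∈ E) (fun g => (1 - (w g : ℝ)))
    rw [← hsplit]
    have h1 : p₀ ^ E.card ≤ ∏ g ∈ (Finset.univ.filter (fun g : Sym2 (Fin n) => ∃ y ∈ Y, y ∈ g)).filter (fun g => g ∈ E), (1 - (w g : ℝ)) := by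
      have hsub : (Finset.univ.filter (fun g : Sym2 (Fin n) => ∃ y ∈ Y, y ∈ g)).filter (fun g => g ∈ E) ⊆ E :=
        fun g hg => (Finset.mem_filter.1 hg).2
      calc p₀ ^ E.card ≤ p₀ ^ ((Finset.univ.filter (fun g : Sym2 (Fin n) => ∃ y ∈ Y, y ∈ g)).filter (fun g => g ∈ E)).card :=
            pow_le_pow_of_le_one hp0.le hp01 (Finset.card_le_card hsub)
        _ = ∏ _g ∈ (Finset.univ.filter (fun g : Sym2 (Fin n) => ∃ y ∈ Y, y ∈ g)).filter (fun g => g ∈ E), p₀ :=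
            (Finset.prod_const p₀).symm
        _ ≤ _ := Finset.prod_le_prod (fun _ _ => hp0.le) fun g hg => by linarith [(hE1 g (Finset.mem_filter.1 hg).2).2]
    have h2 : ∏ g ∈ (Finset.univ.filter (fun g : Sym2 (Fin n) => ∃ y ∈ Y, y ∈ g)).filter (fun g => ¬ g ∈ E), (1 - (w g : ℝ)) = 1 :=
      Finset.prod_eq_one fun g hg => by rw [hE0 g (Finset.mem_filter.1 hg).2, sub_zero]
    rw [h2, mul_one]
    exact h1
  have hpref0 : 0 ≤ p₀ ^ E.card := pow_nonneg hp0.le _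
  have hc0 : 0 ≤ p₀ * (1 - p₀) := mul_nonneg hp0.le (by linarith)
  have hc1 : p₀ * (1 - p₀) ≤ 1 := by nlinarith
  have hcov' : (p₀ * (1 - p₀)) ^ E.card * (f (insert e η₁) - f (η₁ \ {e})) ≤
      (∫ ζ in U, f ζ ∂(prodBernoulli qY)) - (prodBernoulli qY).real U * ∫ ζ, f ζ ∂(prodBernoulli qY) := by
    have hle : (p₀ * (1 - p₀)) ^ E.card ≤ (p₀ * (1 - p₀)) ^ EY.card := pow_le_pow_of_le_one hc0 hc1 hcardEY
    calc (p₀ * (1 - p₀)) ^ E.card * (f (insert e η₁) - f (η₁ \ {e}))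
        ≤ (p₀ * (1 - p₀)) ^ EY.card * (f (insert e η₁) - f (η₁ \ {e})) := mul_le_mul_of_nonneg_right hle hJ0
      _ ≤ _ := by linarith [hcov, mul_comm ((prodBernoulli qY).real U) (∫ ζ, f ζ ∂(prodBernoulli qY))]
  have h := mul_le_mul hpref hcov' (mul_nonneg (pow_nonneg hc0 _) hJ0) (hpref0.trans hpref)
  have hpow : p₀ ^ E.card * ((p₀ * (1 - p₀)) ^ E.card * (f (insert e η₁) - f (η₁ \ {e}))) =
      p₀ ^ E.card * (p₀ * (1 - p₀)) ^ E.card * (f (insert e η₁) - f (η₁ \ {e})) := by ring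
  rw [hpow] at h
  simp only [hY, hU, hqY, hfdef] at h
  exact h

/-- **Explicit (S5) margin from one isolated witness**: weights `w = 0` off `E`, `p₀ ≤ w ≤ 1 − p₀` on `E` (`0 < p₀`); `o ≠ v` off `T`; `F`
monotone nonnegative; `r` injective on `T` and compatible with the means; a relay `a ∈ T`, a pair `e ∈ E` missing `T_{<a}`, witnesses `η₁`
(`F`-jump `J`) and `η₂` (the floor's event at `a`) inside the pairs of `E` missing `T_{<a}`.  Then **`p₀^{|E|}·(p₀(1−p₀))^{|E|} · J ≤ s5dMargin w T r [] o v F`**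
(sharp Harris exponent, row M2-R48). [cite: KozmaNitzan2024, Conj. 4 (p. 32)] [cite: Harris1960, Lemma 4.1 (p. 16)] -/
theorem s5dMargin_nil_ge_explicit_sharp (w : Sym2 (Fin n) → unitInterval) (E : Finset (Sym2 (Fin n))) (p₀ : ℝ) (hp0 : 0 < p₀)
    (hE0 : ∀ f, f ∉ E → (w f : ℝ) = 0) (hE1 : ∀ f ∈ E, p₀ ≤ (w f : ℝ) ∧ (w f : ℝ) ≤ 1 - p₀)
    (T : Finset (Fin n)) (r : Fin n → ℕ) (hr : Set.InjOn r ↑T) (o v : Fin n) (hoT : o ∉ T) (hvT : v ∉ T) (hov : o ≠ v)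
    (F : Set (Fin n) → ℝ) (hF : ∀ S S' : Set (Fin n), S ⊆ S' → F S ≤ F S') (hF0 : ∀ S : Set (Fin n), 0 ≤ F S)
    (hcompat : ∀ a ∈ T, ∀ a' ∈ T, r a < r a' →
      ∫ ω, F (openCluster ω a) ∂(prodBernoulli w) ≤ ∫ ω, F (openCluster ω a') ∂(prodBernoulli w))
    (a : Fin n) (ha : a ∈ T)
    (e : Sym2 (Fin n)) (heE : e ∈ E) (heY : ∀ y ∈ (↑(T.filter (fun b => r b < r a)) : Set (Fin n)), y ∉ e)
    (η₁ : Set (Sym2 (Fin n))) (hη₁ : η₁ ⊆ {f | f ∈ (↑E : Set (Sym2 (Fin n))) ∧ ∀ y ∈ (↑(T.filter (fun b => r b < r a)) : Set (Fin n)), y ∉ f})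
    (η₂ : Set (Sym2 (Fin n))) (hη₂ : η₂ ⊆ {f | f ∈ (↑E : Set (Sym2 (Fin n))) ∧ ∀ y ∈ (↑(T.filter (fun b => r b < r a)) : Set (Fin n)), y ∉ f})
    (hU1 : insert e η₂ ∈ ((⋃ t ∈ (insert a (T.filter (fun b => r a < r b) ∪ ([] : List (Fin n)).toFinset)), openConn o t) ∪ openConn o v :
        Set (BondConfig (Fin n))))
    (hU0 : η₂ \ {e} ∉ ((⋃ t ∈ (insert a (T.filter (fun b => r a < r b) ∪ ([] : List (Fin n)).toFinset)), openConn o t) ∪ openConn o v :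
        Set (BondConfig (Fin n)))) :
    p₀ ^ E.card * (p₀ * (1 - p₀)) ^ E.card *
        (F {c | c = a ∨ ∃ e' ∈ openEdgeCluster (insert e η₁) a, c ∈ e'} - F {c | c = a ∨ ∃ e' ∈ openEdgeCluster (η₁ \ {e}) a, c ∈ e'}) ≤
      s5dMargin w T r [] o v F := by
  have hw1r : ∀ g, (w g : ℝ) < 1 := by
    intro g
    by_cases hg : g ∈ E
    · linarith [(hE1 g hg).2]
    · rw [hE0 g hg]; norm_num
  have hw : ∀ g, w g < 1 := fun g => by
    have h := hw1r g
    exact Subtype.coe_lt_coe.1 (by simpa using h)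
  have hiso := floor_iso_ge_explicit_sharp w E p₀ hp0 hE0 hE1 o v T r ([] : List (Fin n)) a F hF hF0 e heE heY η₁ hη₁ η₂ hη₂ hU1 hU0
  have hnn := fun a' (ha' : a' ∈ T) => isolatedFloor_term_nonneg w o v T r F hF hF0 hcompat a' ha'
  have hsum := Finset.single_le_sum (fun a' ha' => add_nonneg (hnn a' ha').1 (hnn a' ha').2) ha
  have hfloor := s5dMargin_ge_sum_rankGain_add_isolatedFloor_of_lt_one_of_compat w hw o v hov T r F hF hF0 hr hcompat hoT hvT
  linarith [(hnn a ha).1]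

/-- **Explicit master-form (GEN) surplus from one isolated witness (sharp Harris exponent).**  Weights `w = 0` off the finite support `E`,
`p₀ ≤ w ≤ 1 − p₀` on `E` (`0 < p₀`); relays `A` with a rank `r` injective on `A`, compatible with the means, and rank-maximal relay `k ∈ A`;
observer `o ∉ A`; `F` monotone nonnegative; a relay `a ∈ A ∖ k`, a pair `e ∈ E` missing `(A∖k)_{<a}`, an `F(V 𝒞_a)`-witness `η₁` (jump `J`)
and a witness `η₂` of the floor's event at `a` (second observer `k`) inside the pairs of `E` missing `(A∖k)_{<a}`.  Then
**`p₀^{|E|}·(p₀(1−p₀))^{|E|}·J ≤ surplus w A r F o`**  (`Sur_o(A) ≥ s5dMargin(A∖k; o, k)` by the GEN peeling identity, then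
`s5dMargin_nil_ge_explicit_sharp`). [cite: KozmaNitzan2024, Conj. 4 (p. 32), Lemma 2 (p. 6)] [cite: Harris1960, Lemma 4.1 (p. 16)] -/
theorem surplus_ge_explicit_sharp (w : Sym2 (Fin n) → unitInterval) (E : Finset (Sym2 (Fin n))) (p₀ : ℝ) (hp0 : 0 < p₀)
    (hE0 : ∀ f, f ∉ E → (w f : ℝ) = 0) (hE1 : ∀ f ∈ E, p₀ ≤ (w f : ℝ) ∧ (w f : ℝ) ≤ 1 - p₀)
    (A : Finset (Fin n)) (r : Fin n → ℕ) (hr : Set.InjOn r ↑A) (k : Fin n) (hkA : k ∈ A) (hkmax : ∀ a ∈ A, r a ≤ r k)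
    (o : Fin n) (hoA : o ∉ A)
    (F : Set (Fin n) → ℝ) (hF : ∀ S S' : Set (Fin n), S ⊆ S' → F S ≤ F S') (hF0 : ∀ S : Set (Fin n), 0 ≤ F S)
    (hcompat : ∀ a ∈ A, ∀ a' ∈ A, r a < r a' →
      ∫ ω, F (openCluster ω a) ∂(prodBernoulli w) ≤ ∫ ω, F (openCluster ω a') ∂(prodBernoulli w))
    (a : Fin n) (ha : a ∈ A.erase k)
    (e : Sym2 (Fin n)) (heE : e ∈ E) (heY : ∀ y ∈ (↑((A.erase k).filter (fun b => r b < r a)) : Set (Fin n)), y ∉ e)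
    (η₁ : Set (Sym2 (Fin n)))
    (hη₁ : η₁ ⊆ {f | f ∈ (↑E : Set (Sym2 (Fin n))) ∧ ∀ y ∈ (↑((A.erase k).filter (fun b => r b < r a)) : Set (Fin n)), y ∉ f})
    (η₂ : Set (Sym2 (Fin n)))
    (hη₂ : η₂ ⊆ {f | f ∈ (↑E : Set (Sym2 (Fin n))) ∧ ∀ y ∈ (↑((A.erase k).filter (fun b => r b < r a)) : Set (Fin n)), y ∉ f})
    (hU1 : insert e η₂ ∈ ((⋃ t ∈ (insert a ((A.erase k).filter (fun b => r a < r b) ∪ ([] : List (Fin n)).toFinset)), openConn o t) ∪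
        openConn o k : Set (BondConfig (Fin n))))
    (hU0 : η₂ \ {e} ∉ ((⋃ t ∈ (insert a ((A.erase k).filter (fun b => r a < r b) ∪ ([] : List (Fin n)).toFinset)), openConn o t) ∪
        openConn o k : Set (BondConfig (Fin n)))) :
    p₀ ^ E.card * (p₀ * (1 - p₀)) ^ E.card *
        (F {c | c = a ∨ ∃ e' ∈ openEdgeCluster (insert e η₁) a, c ∈ e'} - F {c | c = a ∨ ∃ e' ∈ openEdgeCluster (η₁ \ {e}) a, c ∈ e'}) ≤
      surplus w A r F o := by
  set μ := prodBernoulli w with hμ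
  set T : Finset (Fin n) := A.erase k with hT
  have hTA : ∀ b ∈ T, b ∈ A := fun b hb => Finset.mem_of_mem_erase hb
  have hkT : k ∉ T := Finset.notMem_erase k A
  have hoT : o ∉ T := fun h => hoA (hTA o h)
  have hok : o ≠ k := fun h => hoA (h ▸ hkA)
  have hrT : Set.InjOn r ↑T := hr.mono (fun b hb => Finset.mem_of_mem_erase hb)
  have hcompatT : ∀ b ∈ T, ∀ b' ∈ T, r b < r b' →
      ∫ ω, F (openCluster ω b) ∂μ ≤ ∫ ω, F (openCluster ω b') ∂μ := fun b hb b' hb' h => hcompat b (hTA b hb) b' (hTA b' hb') h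
  -- the (S5) floor at the second observer `k`
  have hs5 := s5dMargin_nil_ge_explicit_sharp w E p₀ hp0 hE0 hE1 T r hrT o k hoT hkT hok F hF hF0 hcompatT a ha e heE heY
    η₁ hη₁ η₂ hη₂ hU1 hU0
  -- `Sur_o(A) ≥ s5dMargin(T; o, k)` from the peeling identity
  have hE0' : ∀ f, f ∉ (↑E : Set (Sym2 (Fin n))) → (w f : ℝ) = 0 := fun f hf => hE0 f (fun h => hf (Finset.mem_coe.2 h))
  have hE1' : ∀ f ∈ (↑E : Set (Sym2 (Fin n))), 0 < (w f : ℝ) ∧ (w f : ℝ) < 1 := fun f hf => by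
    have h := hE1 f (Finset.mem_coe.1 hf)
    exact ⟨lt_of_lt_of_le hp0 h.1, by linarith [h.2]⟩
  have hw : ∀ g, w g < 1 := by
    intro g
    by_cases hg : g ∈ E
    · exact_mod_cast (show (w g : ℝ) < 1 by linarith [(hE1 g hg).2])
    · exact_mod_cast (show (w g : ℝ) < 1 by rw [hE0 g hg]; norm_num)
  obtain ⟨-, h2, h3⟩ := surplus_pieces_nonneg w (↑E) hE0' hE1' A r hr k hkA o hoA F hF hF0 hcompat
  have hid := surplus_peel_top w hw A r F o k hkA hr hkmax
  have hempty : (∅ : BondConfig (Fin n)) ∈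
      {ω : BondConfig (Fin n) | ∀ b ∈ (↑(A.erase k) : Set (Fin n)), ¬ (openGraph ω).Reachable k b} := by
    intro b hb h
    rw [HullPort.reachable_empty_iff] at h
    subst h
    exact (Finset.notMem_erase k A) (Finset.mem_coe.1 hb)
  have hDpos : 0 < μ.real {ω : BondConfig (Fin n) | ∀ b ∈ (↑(A.erase k) : Set (Fin n)), ¬ (openGraph ω).Reachable k b} :=
    prodBernoulli_real_pos_of_empty_mem w hw hempty
  have hmul : μ.real {ω : BondConfig (Fin n) | ∀ b ∈ (↑(A.erase k) : Set (Fin n)), ¬ (openGraph ω).Reachable k b} *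
        s5dMargin w (A.erase k) r [] o k F ≤
      μ.real {ω : BondConfig (Fin n) | ∀ b ∈ (↑(A.erase k) : Set (Fin n)), ¬ (openGraph ω).Reachable k b} * surplus w A r F o := by
    rw [hid]
    linarith [h3, mul_nonneg h2 (measureReal_nonneg :
      0 ≤ μ.real ({ω : BondConfig (Fin n) | ∀ b ∈ (↑(A.erase k) : Set (Fin n)), ¬ (openGraph ω).Reachable k b} ∩ openConn o k))]
  have hSur : s5dMargin w (A.erase k) r [] o k F ≤ surplus w A r F o := le_of_mul_le_mul_left hmul hDpos
  exact hs5.trans hSur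

end CSH

end Summit.CriticalPhenomena.PercolationContinuityZ3.Theorems

end
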